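import Mathlib
import HarnessLib
import Summits.NavierStokesRegularity.NavierStokesRegularity.Theses.SymmetryModuliCount
import Literature.Analysis.FluidPDE.TypeIAncientMildClassical
import Literature.Analysis.FluidPDE.PressurePoisson
import Literature.Analysis.FluidPDE.LocalTypeI

/-!
# `AxisymEndLiouvilleOfFarPastLedger` (stmt-NavierStokesRegularity-14736), 𝒦-route:
# the composition, with every analytic part as an explicit hypothesis

Route SymmetryModuliCount, item `AxisymEndLiouvilleOfFarPastLedger := FarPastLedger → AxisymEndLiouville`.
This file is the LOGIC of the 𝒦-route proof, kernel-checked against hypotheses that are, verbatim,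
the statements of the sibling helper files of the item and of the crux `FarPastLedger`'s pressure
block (so that the final file only instantiates them by name):

* `hNF` (near/far structure of the window pressure for the class `A_C`) is derived here
  (`nearFar_window_of_parts`) from the four stub statements of the crux `FarPastLedger`'s line
  `uloc-gronwall-transplant` — GRADP (`stub_fplPressureGradientBound`), HA
  (`stub_fplSlicePressure`), PIN (`stub_fplPinning`), MD (`stub_fplMeanDisplacement`) — exactly as
  in that line's composition `nearFar_window` (the affine pressure mode is pinned to zero);
* `hPkg` = `pressurePackage_of_nearFar` (`…OfFarPastLedgerPressure.lean`), `hcubic` =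
  `lintegral_parabolicCylinder_le` (`…Cubic.lean`), `hdriver` = `exists_singular_axisymmetric_limit`
  (`…Driver.lean`), `hend` = `false_of_axisymmetric_typeI_singular` (`…Endgame.lean`), `hnormal` =
  `stub_axisNormalForm` (`…AxisymEndLiouvilleStubAxisNormalForm.lean`).

`farPastLedger_imp_axisymEndLiouville_of_parts` : all parts ⇒ `FarPastLedger → AxisymEndLiouville`.
-/

noncomputable section

-- the summit and its single problem share the name (D-0017 nested layout)
set_option linter.dupNamespace false

open MeasureTheory Set Metric Filter Function TopologicalSpace
open scoped ENNReal NNReal Topology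

namespace Summit.NavierStokesRegularity.NavierStokesRegularity.Theorems.AxisymEndLiouvilleOfFarPastLedger

open Literature.Analysis.FluidPDE
open Summit.NavierStokesRegularity.NavierStokesRegularity.Theses.SymmetryModuliCount

/-! ### The near/far structure of the window pressure from the four stubs of the pressure block -/

/-- **Near/far structure of the window pressure of the class `A_C`, from the pressure block of
the crux `FarPastLedger`** (its line `uloc-gronwall-transplant`, composition `nearFar_window`,
reproduced): GRADP bounds `∇p(τ,·)`, HA splits the slice pressure modulo an affine mode `⟪a, x⟫`
whose coefficient is the large-scale average of `∇p`, PIN + MD (the Oseen identity) pin `a = 0`.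
Output: on every window `(t₀, 0)` a classical pressure `p` of `u ∈ A_C` with, at every time and
every centre, `p = c + p₁ + p₂` on `B₂(x₀)`, `‖p₁‖₂² ≤ c₀ (C²/(−τ)) ∫_{B₄(x₀)}‖u‖²`,
`‖∇p₂‖ ≤ c₀ ∫_{|y−x₀|≥3} ‖u‖²|y−x₀|⁻⁴` on `B₂(x₀)`.
[cite: KochNadirashviliSereginSverak2009, §3–4 (the Oseen pressure of bounded mild solutions)] -/
theorem nearFar_window_of_parts {c₀ : ℝ} (hc₀ : 0 ≤ c₀)
    (hGRADP : ∀ (C : ℝ) (u : ℝ → EuclideanSpace ℝ (Fin 3) → EuclideanSpace ℝ (Fin 3)),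
      IsTypeIAncientMild C u → ∀ (t₀ : ℝ) (p : ℝ → EuclideanSpace ℝ (Fin 3) → ℝ),
      IsClassicalNSSolutionOn (Ioo t₀ 0) 1 0 u p →
      ∀ τ ∈ Ioo t₀ 0, ∃ L : ℝ, ∀ x : EuclideanSpace ℝ (Fin 3), ‖fderiv ℝ (p τ) x‖ ≤ L)
    (hHA : ∀ (M L : ℝ) (w : EuclideanSpace ℝ (Fin 3) → EuclideanSpace ℝ (Fin 3))
      (q : EuclideanSpace ℝ (Fin 3) → ℝ),
      ContDiff ℝ (⊤ : ℕ∞) w → ContDiff ℝ (⊤ : ℕ∞) q → VectorCalculus.IsDivFree w →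
      (∀ x, ‖w x‖ ≤ M) → (∀ x, ‖fderiv ℝ q x‖ ≤ L) →
      (∀ x, Laplacian.laplacian q x = -VectorCalculus.divergence (convect w w) x) →
      ∃ a : EuclideanSpace ℝ (Fin 3),
        (∀ x₀ : EuclideanSpace ℝ (Fin 3), ∃ (c : ℝ) (p₁ p₂ : EuclideanSpace ℝ (Fin 3) → ℝ),
          (∀ x ∈ ball x₀ 2, q x = c + inner ℝ a x + p₁ x + p₂ x) ∧ MemLp p₁ 2 volume ∧
          ∫ x, p₁ x ^ 2 ≤ c₀ * M ^ 2 * ∫ x in ball x₀ 4, ‖w x‖ ^ 2 ∧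
          ∀ x ∈ ball x₀ 2, DifferentiableAt ℝ p₂ x ∧
            ‖fderiv ℝ p₂ x‖ ≤ c₀ * ∫ y in (ball x₀ 3)ᶜ, ‖w y‖ ^ 2 / ‖y - x₀‖ ^ 4) ∧
        ∀ r : ℝ, 1 ≤ r →
          ‖(∫ x, ((⟨1, 2, zero_lt_one, one_lt_two⟩ : ContDiffBump (0 : EuclideanSpace ℝ (Fin 3))) :
                EuclideanSpace ℝ (Fin 3) → ℝ) (r⁻¹ • x))⁻¹ •
              (∫ x, (((⟨1, 2, zero_lt_one, one_lt_two⟩ :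
                  ContDiffBump (0 : EuclideanSpace ℝ (Fin 3))) : EuclideanSpace ℝ (Fin 3) → ℝ)
                    (r⁻¹ • x)) • gradient q x) - a‖ ≤ c₀ * M ^ 2 / r)
    (hPIN : ∀ (C : ℝ) (u : ℝ → EuclideanSpace ℝ (Fin 3) → EuclideanSpace ℝ (Fin 3)),
      IsTypeIAncientMild C u → ∀ (t₀ : ℝ) (p : ℝ → EuclideanSpace ℝ (Fin 3) → ℝ),
      IsClassicalNSSolutionOn (Ioo t₀ 0) 1 0 u p →
      ∀ (a : ℝ → EuclideanSpace ℝ (Fin 3)) (κ : ℝ → ℝ),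
      (∀ τ ∈ Ioo t₀ 0, ∀ r : ℝ, 1 ≤ r →
        ‖(∫ x, ((⟨1, 2, zero_lt_one, one_lt_two⟩ : ContDiffBump (0 : EuclideanSpace ℝ (Fin 3))) :
              EuclideanSpace ℝ (Fin 3) → ℝ) (r⁻¹ • x))⁻¹ •
            (∫ x, (((⟨1, 2, zero_lt_one, one_lt_two⟩ :
                ContDiffBump (0 : EuclideanSpace ℝ (Fin 3))) : EuclideanSpace ℝ (Fin 3) → ℝ)
                  (r⁻¹ • x)) • gradient (p τ) x) - a τ‖ ≤ κ τ / r) →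
      (∀ τ₁ τ₂ : ℝ, t₀ < τ₁ → τ₂ < 0 → ∃ K : ℝ, ∀ τ ∈ Icc τ₁ τ₂, κ τ ≤ K) →
      (∀ t₁ t₂ : ℝ, t₁ < t₂ → t₂ < 0 →
        Tendsto (fun r : ℝ => (r ^ 3)⁻¹ •
          ∫ x, (((⟨1, 2, zero_lt_one, one_lt_two⟩ : ContDiffBump (0 : EuclideanSpace ℝ (Fin 3))) :
              EuclideanSpace ℝ (Fin 3) → ℝ) (r⁻¹ • x)) • (u t₂ x - u t₁ x))
          atTop (nhds 0)) →
      ∀ τ ∈ Ioo t₀ 0, a τ = 0)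
    (hMD : ∀ (C : ℝ) (u : ℝ → EuclideanSpace ℝ (Fin 3) → EuclideanSpace ℝ (Fin 3)),
      IsTypeIAncientMild C u → ∀ t₁ t₂ : ℝ, t₁ < t₂ → t₂ < 0 →
      Tendsto (fun r : ℝ => (r ^ 3)⁻¹ •
        ∫ x, (((⟨1, 2, zero_lt_one, one_lt_two⟩ : ContDiffBump (0 : EuclideanSpace ℝ (Fin 3))) :
            EuclideanSpace ℝ (Fin 3) → ℝ) (r⁻¹ • x)) • (u t₂ x - u t₁ x))
        atTop (nhds 0))
    {C : ℝ} {u : ℝ → EuclideanSpace ℝ (Fin 3) → EuclideanSpace ℝ (Fin 3)} (hu : IsTypeIAncientMild C u)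
    {t₀ : ℝ} (ht₀ : t₀ < 0) :
    ∃ p : ℝ → EuclideanSpace ℝ (Fin 3) → ℝ, IsClassicalNSSolutionOn (Ioo t₀ 0) 1 0 u p ∧
      ∀ τ ∈ Ioo t₀ 0, ∀ x₀ : EuclideanSpace ℝ (Fin 3), ∃ (c : ℝ) (p₁ p₂ : EuclideanSpace ℝ (Fin 3) → ℝ),
        (∀ x ∈ ball x₀ 2, p τ x = c + p₁ x + p₂ x) ∧ MemLp p₁ 2 volume ∧
        ∫ x, p₁ x ^ 2 ≤ c₀ * (C ^ 2 / (-τ)) * ∫ x in ball x₀ 4, ‖u τ x‖ ^ 2 ∧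
        ∀ x ∈ ball x₀ 2, DifferentiableAt ℝ p₂ x ∧
          ‖fderiv ℝ p₂ x‖ ≤ c₀ * ∫ y in (ball x₀ 3)ᶜ, ‖u τ y‖ ^ 2 / ‖y - x₀‖ ^ 4 := by
  obtain ⟨p, hp⟩ := hu.exists_isClassicalNSSolutionOn_Ioo ht₀
  refine ⟨p, hp, ?_⟩
  -- the slice lemma at every window time, with `M = C/√(-τ)`
  have hslice : ∀ τ ∈ Ioo t₀ 0, ∃ a : EuclideanSpace ℝ (Fin 3),
      (∀ x₀ : EuclideanSpace ℝ (Fin 3), ∃ (c : ℝ) (p₁ p₂ : EuclideanSpace ℝ (Fin 3) → ℝ),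
        (∀ x ∈ ball x₀ 2, p τ x = c + inner ℝ a x + p₁ x + p₂ x) ∧ MemLp p₁ 2 volume ∧
        ∫ x, p₁ x ^ 2 ≤ c₀ * (C / Real.sqrt (-τ)) ^ 2 * ∫ x in ball x₀ 4, ‖u τ x‖ ^ 2 ∧
        ∀ x ∈ ball x₀ 2, DifferentiableAt ℝ p₂ x ∧
          ‖fderiv ℝ p₂ x‖ ≤ c₀ * ∫ y in (ball x₀ 3)ᶜ, ‖u τ y‖ ^ 2 / ‖y - x₀‖ ^ 4) ∧
      ∀ r : ℝ, 1 ≤ r →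
        ‖(∫ x, ((⟨1, 2, zero_lt_one, one_lt_two⟩ : ContDiffBump (0 : EuclideanSpace ℝ (Fin 3))) :
              EuclideanSpace ℝ (Fin 3) → ℝ) (r⁻¹ • x))⁻¹ •
            (∫ x, (((⟨1, 2, zero_lt_one, one_lt_two⟩ :
                ContDiffBump (0 : EuclideanSpace ℝ (Fin 3))) : EuclideanSpace ℝ (Fin 3) → ℝ)
                  (r⁻¹ • x)) • gradient (p τ) x) - a‖ ≤ c₀ * (C / Real.sqrt (-τ)) ^ 2 / r := by
    intro τ hτ
    have hτ0 : τ < 0 := hτ.2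
    obtain ⟨L, hL⟩ := hGRADP C u hu t₀ p hp τ hτ
    refine hHA (C / Real.sqrt (-τ)) L (u τ) (p τ) (hu.contDiff_slice hτ0) (hp.contDiff_pressure hτ)
      (hu.isDivFree hτ0) (fun x => hu.norm_le hτ0 x) hL fun x => ?_
    have hint : τ ∈ interior (Ioo t₀ 0) := by rw [isOpen_Ioo.interior_eq]; exact hτ
    have key := laplacian_pressure_eq_of_isClassicalNSSolutionOn hp hint x
    simpa [VectorCalculus.divergence] using key
  choose! a ha using hslice
  -- pinning: the affine mode vanishes
  have hpin : ∀ τ ∈ Ioo t₀ 0, a τ = 0 := by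
    refine hPIN C u hu t₀ p hp a (fun τ => c₀ * (C / Real.sqrt (-τ)) ^ 2)
      (fun τ hτ r hr => (ha τ hτ).2 r hr) (fun τ₁ τ₂ _ h₂ => ?_) (hMD C u hu)
    refine ⟨c₀ * (C ^ 2 / (-τ₂)), fun τ hτ => ?_⟩
    have hτ0 : τ < 0 := lt_of_le_of_lt hτ.2 h₂
    have e : (C / Real.sqrt (-τ)) ^ 2 = C ^ 2 / (-τ) := by
      rw [div_pow, Real.sq_sqrt (by linarith)]
    rw [e]
    refine mul_le_mul_of_nonneg_left ?_ hc₀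
    exact div_le_div_of_nonneg_left (sq_nonneg C) (by linarith) (by linarith [hτ.2])
  -- assemble
  intro τ hτ x₀
  obtain ⟨c, p₁, p₂, hdec, hmem, hnear, hfar⟩ := (ha τ hτ).1 x₀
  refine ⟨c, p₁, p₂, fun x hx => ?_, hmem, ?_, hfar⟩
  · rw [hdec x hx, hpin τ hτ, inner_zero_left, add_zero]
  · have e : (C / Real.sqrt (-τ)) ^ 2 = C ^ 2 / (-τ) := by
      rw [div_pow, Real.sq_sqrt (by linarith [hτ.2])]
    rw [← e]
    exact hnear

/-! ### The composition -/

/-- **The 𝒦-route composition: all parts ⇒ `FarPastLedger → AxisymEndLiouville`.** Given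
(verbatim statements of the helper files) the near/far structure `hNF` at the centre `0` on the
window `(−3,0)`, the pressure package `hPkg`, the cubic bound `hcubic`, the blow-down driver
`hdriver`, the endgame `hend` and the axis normal form `hnormal`: if `FarPastLedger` holds, an
element `u ∈ A_C` annihilated on a backward end by the rotations about any axis vanishes on that
end. Proof: normal form ⇒ `v ∈ A_C` axisymmetric about the `x₃`-axis on `t < 0`; if
`v(t₀, x₀) ≠ 0`, the driver (fed by `FarPastLedger`'s constant `K(C)`, the cubic bound and the
pressure package) produces a singular a.e.-axisymmetric a.e.-Type-I limit in a parabolic ball,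
which the endgame (Seregin–Šverák 2009, Thm 3.1) forbids. [cite: SereginSverak2009, Thm 3.1 (= Thm 1.1)] -/
theorem farPastLedger_imp_axisymEndLiouville_of_parts {c₀ : ℝ}
    (hShell : ∃ cS : ℝ, 0 ≤ cS ∧ ∀ g : EuclideanSpace ℝ (Fin 3) → ℝ, Continuous g → (∀ x, 0 ≤ g x) →
      (∃ M : ℝ, ∀ x, g x ≤ M) → ∀ (B : ℝ) (x₁ : EuclideanSpace ℝ (Fin 3)),
      (∀ z : EuclideanSpace ℝ (Fin 3), ∫ x in ball z 1, g x ≤ B) →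
        IntegrableOn (fun y => g y / ‖y - x₁‖ ^ 4) (ball x₁ 3)ᶜ volume ∧
          ∫ y in (ball x₁ 3)ᶜ, g y / ‖y - x₁‖ ^ 4 ≤ cS * B)
    (hNF : ∀ (C : ℝ) (w : ℝ → EuclideanSpace ℝ (Fin 3) → EuclideanSpace ℝ (Fin 3)), IsTypeIAncientMild C w →
      ∃ p : ℝ → EuclideanSpace ℝ (Fin 3) → ℝ, IsClassicalNSSolutionOn (Ioo (-3) 0) 1 0 w p ∧
        ∀ τ ∈ Ioo (-3 : ℝ) 0, ∃ (c : ℝ) (p₁ p₂ : EuclideanSpace ℝ (Fin 3) → ℝ),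
          (∀ x ∈ ball (0 : EuclideanSpace ℝ (Fin 3)) 2, p τ x = c + p₁ x + p₂ x) ∧ MemLp p₁ 2 volume ∧
          ∫ x, p₁ x ^ 2 ≤ c₀ * (C ^ 2 / (-τ)) * ∫ x in ball (0 : EuclideanSpace ℝ (Fin 3)) 4, ‖w τ x‖ ^ 2 ∧
          ∀ x ∈ ball (0 : EuclideanSpace ℝ (Fin 3)) 2, DifferentiableAt ℝ p₂ x ∧
            ‖fderiv ℝ p₂ x‖ ≤ c₀ * ∫ y in (ball (0 : EuclideanSpace ℝ (Fin 3)) 3)ᶜ,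
              ‖w τ y‖ ^ 2 / ‖y - (0 : EuclideanSpace ℝ (Fin 3))‖ ^ 4)
    (hPkg : ∀ (C K cS : ℝ), 0 ≤ cS →
      (∀ g : EuclideanSpace ℝ (Fin 3) → ℝ, Continuous g → (∀ x, 0 ≤ g x) → (∃ M : ℝ, ∀ x, g x ≤ M) →
        ∀ (B : ℝ) (x₁ : EuclideanSpace ℝ (Fin 3)),
        (∀ z : EuclideanSpace ℝ (Fin 3), ∫ x in ball z 1, g x ≤ B) →
          IntegrableOn (fun y => g y / ‖y - x₁‖ ^ 4) (ball x₁ 3)ᶜ volume ∧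
            ∫ y in (ball x₁ 3)ᶜ, g y / ‖y - x₁‖ ^ 4 ≤ cS * B) →
      (∀ w : ℝ → EuclideanSpace ℝ (Fin 3) → EuclideanSpace ℝ (Fin 3), IsTypeIAncientMild C w →
        ∃ p : ℝ → EuclideanSpace ℝ (Fin 3) → ℝ, IsClassicalNSSolutionOn (Ioo (-3) 0) 1 0 w p ∧
          ∀ τ ∈ Ioo (-3 : ℝ) 0, ∃ (c : ℝ) (p₁ p₂ : EuclideanSpace ℝ (Fin 3) → ℝ),
            (∀ x ∈ ball (0 : EuclideanSpace ℝ (Fin 3)) 2, p τ x = c + p₁ x + p₂ x) ∧ MemLp p₁ 2 volume ∧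
            ∫ x, p₁ x ^ 2 ≤ c₀ * (C ^ 2 / (-τ)) * ∫ x in ball (0 : EuclideanSpace ℝ (Fin 3)) 4, ‖w τ x‖ ^ 2 ∧
            ∀ x ∈ ball (0 : EuclideanSpace ℝ (Fin 3)) 2, DifferentiableAt ℝ p₂ x ∧
              ‖fderiv ℝ p₂ x‖ ≤ c₀ * ∫ y in (ball (0 : EuclideanSpace ℝ (Fin 3)) 3)ᶜ,
                ‖w τ y‖ ^ 2 / ‖y - (0 : EuclideanSpace ℝ (Fin 3))‖ ^ 4) →
      ∃ D₀ : ℝ, ∀ w : ℝ → EuclideanSpace ℝ (Fin 3) → EuclideanSpace ℝ (Fin 3), IsTypeIAncientMild C w →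
        (∀ t < 0, ∀ (x₀ : EuclideanSpace ℝ (Fin 3)) (R : ℝ), 0 < R →
          ∫ x in ball x₀ R, ‖w t x‖ ^ 2 ≤ K * R) →
        ∀ T ∈ Ioc (0 : ℝ) 1, ∃ q : ℝ → EuclideanSpace ℝ (Fin 3) → ℝ,
          IsSuitableWeakSolutionInBall 1 0 (fun s y => w (s - T) y) q ∧
          ∫⁻ z in parabolicCylinder 1 (0 : ℝ × EuclideanSpace ℝ (Fin 3)), ‖q z.1 z.2‖ₑ ^ (3 / 2 : ℝ) ≤
            ENNReal.ofReal D₀)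
    (hcubic : ∀ (C K : ℝ) (w : ℝ → EuclideanSpace ℝ (Fin 3) → EuclideanSpace ℝ (Fin 3)), IsTypeIAncientMild C w →
      (∀ t < 0, ∀ (x₀ : EuclideanSpace ℝ (Fin 3)) (R : ℝ), 0 < R →
        ∫ x in ball x₀ R, ‖w t x‖ ^ 2 ≤ K * R) →
      ∫⁻ z in parabolicCylinder 1 (0 : ℝ × EuclideanSpace ℝ (Fin 3)), ‖w z.1 z.2‖ₑ ^ (3 : ℕ) ≤
        ENNReal.ofReal (2 * C * K))
    (hdriver : ∀ (C K D₀ : ℝ),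
      (∀ w : ℝ → EuclideanSpace ℝ (Fin 3) → EuclideanSpace ℝ (Fin 3), IsTypeIAncientMild C w →
        (∀ t < 0, ∀ (x₀ : EuclideanSpace ℝ (Fin 3)) (R : ℝ), 0 < R →
          ∫ x in ball x₀ R, ‖w t x‖ ^ 2 ≤ K * R) →
        ∫⁻ z in parabolicCylinder 1 (0 : ℝ × EuclideanSpace ℝ (Fin 3)), ‖w z.1 z.2‖ₑ ^ (3 : ℕ) ≤
          ENNReal.ofReal (2 * C * K)) →
      (∀ w : ℝ → EuclideanSpace ℝ (Fin 3) → EuclideanSpace ℝ (Fin 3), IsTypeIAncientMild C w →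
        (∀ t < 0, ∀ (x₀ : EuclideanSpace ℝ (Fin 3)) (R : ℝ), 0 < R →
          ∫ x in ball x₀ R, ‖w t x‖ ^ 2 ≤ K * R) →
        ∀ T ∈ Ioc (0 : ℝ) 1, ∃ q : ℝ → EuclideanSpace ℝ (Fin 3) → ℝ,
          IsSuitableWeakSolutionInBall 1 0 (fun s y => w (s - T) y) q ∧
          ∫⁻ z in parabolicCylinder 1 (0 : ℝ × EuclideanSpace ℝ (Fin 3)), ‖q z.1 z.2‖ₑ ^ (3 / 2 : ℝ) ≤
            ENNReal.ofReal D₀) →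
      ∀ {v : ℝ → EuclideanSpace ℝ (Fin 3) → EuclideanSpace ℝ (Fin 3)}, IsTypeIAncientMild C v →
        (∀ t < 0, ∀ (x₀ : EuclideanSpace ℝ (Fin 3)) (R : ℝ), 0 < R →
          ∫ x in ball x₀ R, ‖v t x‖ ^ 2 ≤ K * R) →
        (∀ t < 0, IsAxisymmetric (v t)) →
        ∀ {t₀ : ℝ}, t₀ < 0 → ∀ {x₀ : EuclideanSpace ℝ (Fin 3)}, v t₀ x₀ ≠ 0 →
        ∃ (u : ℝ → EuclideanSpace ℝ (Fin 3) → EuclideanSpace ℝ (Fin 3)) (p : ℝ → EuclideanSpace ℝ (Fin 3) → ℝ),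
          IsSuitableWeakSolutionInBall (1 / 2) 0 u p ∧
          MemLp (uncurry u) 3 (volume.restrict (parabolicCylinder (1 / 2) (0 : ℝ × EuclideanSpace ℝ (Fin 3)))) ∧
          (∀ θ : ℝ, ∀ᵐ z ∂(volume.restrict (parabolicCylinder (1 / 2) (0 : ℝ × EuclideanSpace ℝ (Fin 3)))),
            rotZ θ (u z.1 (rotZ (-θ) z.2)) = u z.1 z.2) ∧
          (∀ᵐ z ∂(volume.restrict (parabolicCylinder (1 / 2) (0 : ℝ × EuclideanSpace ℝ (Fin 3)))),
            Real.sqrt (-z.1) * ‖u z.1 z.2‖ ≤ C) ∧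
          IsBackwardSingularPoint u 0)
    (hend : ∀ {u : ℝ → EuclideanSpace ℝ (Fin 3) → EuclideanSpace ℝ (Fin 3)}
      {p : ℝ → EuclideanSpace ℝ (Fin 3) → ℝ} {R C : ℝ}, 0 < R →
      IsSuitableWeakSolutionInBall R 0 u p →
      MemLp (uncurry u) 3 (volume.restrict (parabolicCylinder R (0 : ℝ × EuclideanSpace ℝ (Fin 3)))) →
      (∀ θ : ℝ, ∀ᵐ w ∂(volume.restrict (parabolicCylinder R (0 : ℝ × EuclideanSpace ℝ (Fin 3)))),
        rotZ θ (u w.1 (rotZ (-θ) w.2)) = u w.1 w.2) →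
      (∀ᵐ w ∂(volume.restrict (parabolicCylinder R (0 : ℝ × EuclideanSpace ℝ (Fin 3)))),
        Real.sqrt (-w.1) * ‖u w.1 w.2‖ ≤ C) →
      IsBackwardSingularPoint u 0 → False)
    (hnormal : ∀ (C : ℝ) (u : ℝ → EuclideanSpace ℝ (Fin 3) → EuclideanSpace ℝ (Fin 3)), IsTypeIAncientMild C u →
      ∀ (c : EuclideanSpace ℝ (Fin 3)) (A : EuclideanSpace ℝ (Fin 3) →L[ℝ] EuclideanSpace ℝ (Fin 3)) (θ : ℝ),
      (∀ x, inner ℝ (A x) x = 0) → A ≠ 0 → θ ≤ 0 →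
      (∀ t < θ, ∀ x, fderiv ℝ (u t) x (A (x - c)) - A (u t x) = 0) →
      ∃ v : ℝ → EuclideanSpace ℝ (Fin 3) → EuclideanSpace ℝ (Fin 3), IsTypeIAncientMild C v ∧
        (∀ t < 0, IsAxisymmetric (v t)) ∧ ((∀ t < 0, ∀ y, v t y = 0) → ∀ t < θ, ∀ x, u t x = 0)) :
    FarPastLedger → AxisymEndLiouville := by
  intro hFPL C u hu c A θ hskew hA hθ hsym
  obtain ⟨v, hv, hvax, htransfer⟩ := hnormal C u hu c A θ hskew hA hθ hsym
  refine htransfer fun t ht y => ?_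
  -- the core: an axisymmetric element of `A_C` with the ledger vanishes
  by_contra hne
  obtain ⟨K, hK⟩ := hFPL C
  obtain ⟨cS, hcS0, hS⟩ := hShell
  obtain ⟨D₀, hPress⟩ := hPkg C K cS hcS0 hS (hNF C)
  obtain ⟨u', p', hball, hL3, hsymu, htypeI, hsing⟩ :=
    hdriver C K D₀ (hcubic C K) hPress hv (hK v hv) hvax ht hne
  exact hend (by norm_num) hball hL3 hsymu htypeI hsing

end Summit.NavierStokesRegularity.NavierStokesRegularity.Theorems.AxisymEndLiouvilleOfFarPastLedger

end
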